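import Mathlib
import Summits.NavierStokesRegularity.NavierStokesRegularity.Theorems.TaoLadderRungTwoFlatEntryHop
import Summits.NavierStokesRegularity.NavierStokesRegularity.Theorems.TaoLadderRungTwoFlatCoScaledReference
import HarnessLib

/-!
# TWO SMALL PRODUCERS FOR THE EXISTENCE CHAIN (K4): the landing rows of the CHOICE RULE (`t_lo ≤ τ₁`, `a ≤ a_max` from the clock window and a
  carrier hull) and the CAPS of a tube state of the split R54 tube (behind cap from the slot's (B2∃); `ω`-bound from the clauses)
  (helper for the K_A♭ parent item stmt-NavierStokesRegularity-22987 `FlatGapCertificatesV2`, child 2A `GradedAdiabaticWakeA` of route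
  TaoLadderRungTwoFlat; cell harvest/h2-tao-ladder, p1 g25; LADDER §50 (K4), `tubeExistWith_of_phases` inputs `hlanding` (rows) and `hcaps`)

* `landingRows_of_choiceRule` — for `rule = choiceRule P i₀ ε₀ θ₀ t₀ good`: along every premise, `t_lo ≤ τ₁` (the chosen time is good, good
  times are `≥ t_lo`) and `a ≤ max(f, C₁/A_*)` (the clamped ratio is read off the carrier `|S_{i₀,1}(τ₁)| ≤ C₁`, `clampedRatio_le_of_carrier`);
* `caps_of_inTubeWith_split` — for a state of `H(n)`, `n > N₀`, of the split R54 tube: the behind cap `Λ` of the slot's (B2∃) clause and an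
  `ω`-bound `B_z = max(Ω_b Λ, Ω_K (M_u + δ(n)/g_min), Ω_w r/8)` for any weight `ω` bounded by `Ω_b` behind, by `Ω_K` below `k₁`, by `Ω_w·w`
  everywhere (the banach weight of `…BanachWeight` qualifies).

HONEST FRAMING: bookkeeping over the cell's typed induction frame (MODEL lattice); nothing certified; no item closed; nothing about the
Navier–Stokes equations.
-/

noncomputable section

-- the sub-problem namespace repeats the summit name by design (D-0017)
set_option linter.dupNamespace false

namespace Summit.NavierStokesRegularity.NavierStokesRegularity.Theorems.HopTube

open Set Finset Literature.Analysis.FluidPDE Literature.Analysis.FluidPDE.TaoCascade MirrorPulse GappedFrontRobustOn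

/-- **Landing rows of the choice rule**: `t_lo ≤ τ₁` and `a ≤ max((1+ε₀)^{−θ₀}, C₁/A_*)` along every premise, from the existence of a good time, the
clock window of good times, and a carrier hull `|S_{i₀,1}(t)| ≤ C₁` at good times. [cite: Tao2016AveragedNS, §6.4 Prop. 6.5 (statement shape); cell certificate format v2 (HopRule), LADDER §50] -/
theorem landingRows_of_choiceRule (P : TubeSchedule) {Bcl : ℕ → (Fin 2 → ℤ → ℝ) → Prop} {𝕊 : Finset (ℤ × ℤ × ℤ)} {ε₀ : ℝ} {i₀ : Fin 2}
    {α : Fin 2 → Fin 2 → Fin 2 → ℤ × ℤ × ℤ → ℝ} {X₀ : Fin 2 → ℝ} {w : ℤ → ℝ} {r θ₀ c₀ t₀ tlo C₁ : ℝ} {ζ : ℕ → Fin 2 → ℤ → ℝ}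
    {ustar : Fin 2 → ℤ → ℝ} {good : ℕ → (Fin 2 → ℤ → ℝ → ℝ) → ℝ → Prop} {n : ℕ} (hA : 0 < P.Astar)
    (hex : ∀ z S₀ τ S F, HopPremiseWith P Bcl 𝕊 ε₀ i₀ α X₀ w r c₀ ζ ustar n z S₀ τ S F → ∃ t, good n S t)
    (hwin : ∀ z S₀ τ S F, HopPremiseWith P Bcl 𝕊 ε₀ i₀ α X₀ w r c₀ ζ ustar n z S₀ τ S F → ∀ t, good n S t → tlo ≤ t ∧ t ≤ c₀)
    (hC₁ : ∀ z S₀ τ S F, HopPremiseWith P Bcl 𝕊 ε₀ i₀ α X₀ w r c₀ ζ ustar n z S₀ τ S F → ∀ t, good n S t → |S i₀ 1 t| ≤ C₁) :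
    ∀ z S₀ τ S F, HopPremiseWith P Bcl 𝕊 ε₀ i₀ α X₀ w r c₀ ζ ustar n z S₀ τ S F →
      tlo ≤ (choiceRule P i₀ ε₀ θ₀ t₀ good).τ₁ n S ∧
        (choiceRule P i₀ ε₀ θ₀ t₀ good).a n S ≤ max ((1 + ε₀) ^ (-θ₀)) (C₁ / P.Astar) := by
  intro z S₀ τ S F h
  have hg := chooseTime_spec (t₀ := t₀) (hex z S₀ τ S F h)
  simp only [choiceRule_τ₁, choiceRule_a]
  exact ⟨(hwin z S₀ τ S F h _ hg).1, clampedRatio_le_of_carrier P i₀ ε₀ θ₀ _ S hA (hC₁ z S₀ τ S F h _ hg)⟩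

/-- **Caps of a tube state of the split R54 tube** (`n > N₀`): the behind cap of the slot's (B2∃) clause, and an `ω`-bound from the ahead clause
(`k ≥ k₁`: `ω ≤ Ω_w w`, `8w|z| ≤ r`), the core clause below `k₁` (`|z| ≤ |u⋆| + δ(n)/g_min`, `ω ≤ Ω_K`) and the cap behind (`ω ≤ Ω_b`).
[cite: Tao2016AveragedNS, §6.2 Prop. 6.3 (ix), §6.3–6.4 (statement shape); cell LADDER §50 (clauses), §57.5 (behindR54), K4 (`hcaps`)] -/
theorem caps_of_inTubeWith_split (P : TubeSchedule) {θ' : ℝ} {Wb δs : ℕ → ℝ} {i₀ : Fin 2} {X₀ : Fin 2 → ℝ} {w ω : ℤ → ℝ} {r : ℝ}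
    {ζ : ℕ → Fin 2 → ℤ → ℝ} {ustar : Fin 2 → ℤ → ℝ} {n : ℕ} {z : Fin 2 → ℤ → ℝ}
    (hn : P.N₀ < n) (hA : 0 < P.Astar) (hw0 : ∀ k, 0 < w k)
    {Ωw ΩK Ωb gmin Mu : ℝ} (hΩw : 0 ≤ Ωw) (hωw : ∀ k, ω k ≤ Ωw * w k)
    (hΩK : 0 ≤ ΩK) (hωK : ∀ k, k < (P.k₁ : ℤ) → ω k ≤ ΩK) (hΩb : 0 ≤ Ωb) (hωb : ∀ k, k < -(P.K : ℤ) → ω k ≤ Ωb)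
    (hgmin : 0 < gmin) (hgminle : ∀ (i : Fin 2) (k : ℤ), -(P.K : ℤ) ≤ k → gmin ≤ MirrorPulse.geomGauge P.g P.b i k)
    (hu : ∀ (i : Fin 2) (k : ℤ), -(P.K : ℤ) ≤ k → k < (P.k₁ : ℤ) → |ustar i k| ≤ Mu)
    (hz : InTubeWith P (splitBcl P (behindR54 P θ' Wb) δs i₀ ustar) i₀ X₀ w r ζ ustar n z) :
    ∃ Λb Bz : ℝ, 0 ≤ Λb ∧ (∀ (i : Fin 2) (k : ℤ), k < -(P.K : ℤ) → |z i k| ≤ Λb) ∧ (∀ (i : Fin 2) (k : ℤ), ω k * |z i k| ≤ Bz) := by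
  have h0 : n ≠ 0 := by omega
  have h1 : ¬ n ≤ P.N₀ := by omega
  simp only [InTubeWith, h0, if_false, h1] at hz
  obtain ⟨hanch, hcore, -, ⟨⟨-, Λ, hΛ0, hcap⟩, -⟩, hahead⟩ := hz
  have hx1 : anchorScale P i₀ z ≤ 1 := anchorScale_le_one_of_anchorClause P hA hanch
  have hx0 : 0 ≤ anchorScale P i₀ z := by unfold anchorScale; positivity
  refine ⟨Λ, max (Ωb * Λ) (max (ΩK * (Mu + P.δ n / gmin)) (Ωw * r / 8)), hΛ0, fun i k hk => hcap i k hk, fun i k => ?_⟩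
  rcases lt_or_ge k (-(P.K : ℤ)) with hkB | hkB
  · -- behind: the cap
    calc ω k * |z i k| ≤ Ωb * Λ := mul_le_mul (hωb k hkB) (hcap i k hkB) (abs_nonneg _) hΩb
      _ ≤ _ := le_max_left _ _
  rcases lt_or_ge k (P.k₁ : ℤ) with hkW | hkW
  · -- window below `k₁`: core clause + template
    have hc := hcore i k hkB
    have hgk := hgminle i k hkB
    have hdev : |z i k - anchorScale P i₀ z * ustar i k| ≤ P.δ n / gmin := by
      rw [le_div_iff₀ hgmin]
      calc |z i k - anchorScale P i₀ z * ustar i k| * gmin ≤ |z i k - anchorScale P i₀ z * ustar i k|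
            * MirrorPulse.geomGauge P.g P.b i k := mul_le_mul_of_nonneg_left hgk (abs_nonneg _)
        _ ≤ P.δ n := by rw [mul_comm]; exact hc
    have hxu : |anchorScale P i₀ z * ustar i k| ≤ Mu := by
      rw [abs_mul, abs_of_nonneg hx0]
      calc anchorScale P i₀ z * |ustar i k| ≤ 1 * Mu := mul_le_mul hx1 (hu i k hkB hkW) (abs_nonneg _) zero_le_one
        _ = Mu := one_mul _
    have hzk : |z i k| ≤ Mu + P.δ n / gmin := by
      have := abs_sub_abs_le_abs_sub (z i k) (anchorScale P i₀ z * ustar i k); linarith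
    calc ω k * |z i k| ≤ ΩK * (Mu + P.δ n / gmin) := mul_le_mul (hωK k hkW) hzk (abs_nonneg _) hΩK
      _ ≤ _ := (le_max_left _ _).trans (le_max_right _ _)
  · -- ahead of `k₁`: the ahead clause
    have h8 := hahead i k hkW
    have hzk : |z i k| ≤ r / (8 * w k) := by rw [le_div_iff₀ (by have := hw0 k; positivity)]; linarith
    calc ω k * |z i k| ≤ Ωw * w k * (r / (8 * w k)) := mul_le_mul (hωw k) hzk (abs_nonneg _) (by have := hw0 k; positivity)
      _ = Ωw * r / 8 := by have hwk := (hw0 k).ne'; field_simp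
      _ ≤ _ := (le_max_right _ _).trans (le_max_right _ _)

end Summit.NavierStokesRegularity.NavierStokesRegularity.Theorems.HopTube

end
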